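/-
Copyright (c) 2026 the pub-hodgecm-mathlib formalisation cell (harness21).  Prover seat hodgecm-mathlib-K2E5-p16 (g8): Track B «K2-LIT»,
hLiu418 = stmt-HodgeConjecture-24832; LEAD F0P6-plan (g14) BATCH #85 (1) «K1-a♮, (K1a-2)» (line lead K2E5-p16 (g8)); K1 desk F0P2-p11 (g2).
-/
import Summits.HodgeConjecture.HodgeConjecture.Theorems.K2LiuSiegelCocycleSphericalValue    -- ★ (F-GK-2) p862057: the untwisted chain, `measureReal_box_eq`; brings ★ B7, ★ B4d-3, ★ B4-abs, ★ F-GK-1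
import HarnessLib

/-!
# Crux `HLiu418`, road `K2_Liu`, socket #41 KIND 1 a♮ (the singular big-cell term), organ (K1a-GK), file (K1a-2):
# THE TWISTED SIEGEL INTEGRAL `∫_{N_Δ(F_v)} ψ(b₁(u)·τ) f(w_Δ u h) dνN(u)` OF A SPHERICAL SECTION, BY THE COCYCLE — non-split place, ONE FRAME, RAW FORM

Cell `hodgecm-mathlib`, crux item hLiu418 = `stmt-HodgeConjecture-24832`; squad K2 ∕ K2Liu; prover K2E5-p16 (g8) = line lead of K1-a♮ (LEAD F0P6-plan (g14)
BATCH #85 (1)); census `K2/K2E5-p16/g8/CENSUS-K1a-GK.K2E5-p16-g8.md` 7c6ffe7718f089b5.  THEOREMS ONLY (no `def`, no instance, no notation, no named-fact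
hypothesis, no `sorry`); lane `--supports stmt-HodgeConjecture-24832 --as helper` (count-neutral helper).  ONE FRAME (RULING M-156o (c)): `φ := frameConj Q ∘ toLocalFour`.

THE POINT ([KudlaRallis1994, §2], [Shimura1997, §13.6, §18.4], [Casselman1980, §3 Thm. 3.1]).  The rank-one (singular) Fourier coefficient of the Siegel
Eisenstein series on `H = U(2,2)` is, locally at a finite place and after the corner transport of (K1a-1), the TWISTED Siegel integral
`W_{σ,v}(f)(h) = ∫_{N_Δ(F_v)} ψ_v(b₁(u)·τ) f(w_Δ u h) dνN(u)`, where `b₁(u)` is the FIRST coordinate of `u` in the cocycle coordinates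
`e(b₁, z, b₂) = φ(n(ι_v(b₁)δ, z, ι_v(b₂)δ))` of ★ B1b-2b ∕ ★ B4d-3 — the corner index pairs with that slot only (★ `adapt_matA_frameConj_nSiegel`: the Siegel block of
`φ(n(x,z,y))` is `!![z, y; x, −z̄]·Dinv_v` and `Dinv = 2·W·T₀` is antidiagonal for the diagonal Gram datum), and that slot is the INNERMOST letter of the cocycle word
`φ(w_Δ^J)·e(x,z,y) = φ(w₂)φ(u(ι(y)δ)) · φ(w₁)φ(u₋(z)) · φ(w₂)φ(u(ι(x)δ))` (★ `frameConj_weylSiegel_mul_coord`), i.e. the OUTERMOST integral of ★ B4d-3's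
`∫_x ∫_z ∫_y`.  Hence the two inner stages of ★ (F-GK-2) p862057 §2 run VERBATIM (untwisted; (F-GK-1) p861981 at the point) and only the last stage is twisted:
* §1 **`integral_addChar_mul_eq_of_spherical_of_forall_eq`** — RAW VALUE, hypothesis-first on the TWISTED RANK-ONE STAGE `htw` (BY VALUE: for every right-`K₀`-invariant
  `Φ` with the stage-C relation `Φ(φ(w₂)u(x)g) = C₃ χ_F(x)⁻¹ ‖x‖^{−2s} Φ(ū(x⁻¹)g)` and `Φ(φ(w₂)h) = Φ(h)`, `∫ ψ(xτ)Φ(φ(w₂)u(x)h) dμ_F = μ_F(𝒪)·Tw·Φ(h)` — the letter of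
  `Theorems/K2LiuRankOneWhittakerPolynomialSigned` (LH7-p06 (g2)), Tate's shell sum `Tw = 1 + C₃(Σ_{1≤k≤M} X^k − q⁻¹Σ_{1≤k≤M+1} X^k)`, `X = χ_F(ϖ)q^{1−2s}`, `M = ord τ`):
  **`∫ ψ((e⁻¹u)₁·τ) f(w_Δ u h) dνN(u) = χ_s(m₀) · νN(BOX) · G₁(s) · G₂(s) · Tw · f(h)`** with `G₁, G₂` the two untwisted stage factors of ★ p862057 §2
  (`(C₁, χ_F, 2s+2)`, `(χ_w(−1), χ_F∘N, 2s+1)`), `m₀ = w_Δ φ(w_Δ^J)`, `BOX` the integral coordinate box.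
The CM transport (★ (d1) `unipDeltaChar_locToAdelic_eq_prod`, ★ B1 §3, `τ = −2·t₁·σ♭·δ`) and the discharge of `htw`, `χ_s(m₀)`, `C₁`, `χ_w(−1)`, `C₃` at a good place are the sequel
(K1a-2d) `K2LiuRankOneSingularLocalValueCM`; the split-place twin is (K1a-2c).
HONEST LABEL.  `HC_CM` is proved only modulo the 7 printed citations (2 remaining named inputs: hLiu418 = `stmt-HodgeConjecture-24832`,
h413 = `stmt-HodgeConjecture-24833`) until rung 0 closes.

## References
* [KudlaRallis1994] S. Kudla, S. Rallis, Ann. of Math. 140 (1994), §2 (singular Fourier coefficients via `i* ∘ U(s)`).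
* [Shimura1997] G. Shimura, *Euler Products and Eisenstein Series*, CBMS 93 (1997), §13.6, §18.4–18.5 (singular series of rank `r`).
* [Casselman1980] W. Casselman, Compositio Math. 40 (1980), §3 Thm. 3.1 (the cocycle `s₂ s₁ s₂`).
* [HarrisKudlaSweet1996] M. Harris, S. Kudla, W. J. Sweet, J. AMS 9 (1996), §1 (1.11)–(1.12), §6 (6.14)–(6.16).
* [Tate1950] J. Tate, *Fourier analysis in number fields and Hecke's zeta-functions* (1950), §2.4–2.5.
* [Weil1965] A. Weil, Acta Math. 113 (1965), §37 (Haar measures in coordinates).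
-/

set_option autoImplicit false
set_option linter.dupNamespace false -- the mandated namespace repeats `HodgeConjecture.HodgeConjecture`

noncomputable section

open scoped Classical NNReal ENNReal
open NumberField IsDedekindDomain Matrix MeasureTheory Topology
open Literature.NumberTheory.GaloisRepresentations.IsNonarchimedeanLocalField
open Literature.NumberTheory.Automorphic Literature.NumberTheory.Automorphic.UnitaryGroup
open Literature.NumberTheory.GelbartRogawski1991.AdaptedBlocks
open Literature.NumberTheory.GelbartRogawski1991.UnitaryDualPair.LocalSplitting
open Literature.NumberTheory.K2Lit.LocalSiegelDoubled
open Summit.HodgeConjecture.HodgeConjecture.Cruxes.HLiu418.K2LiuQRationalDefs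
open Summit.HodgeConjecture.HodgeConjecture.Cruxes.HLiu418.K2LiuQRationalLFactor
open Summit.HodgeConjecture.HodgeConjecture.Cruxes.HLiu418.K2LiuLocalLFactorDefs
open Summit.HodgeConjecture.HodgeConjecture.Cruxes.HLiu418.K2LiuLocalSiegelIwasawaFrame
open Summit.HodgeConjecture.HodgeConjecture.Cruxes.HLiu418.K2LiuLocalSiegelIwasawa
open Summit.HodgeConjecture.HodgeConjecture.Cruxes.HLiu418.K2LiuDoubledUTwoTwoBorelFrame
open Summit.HodgeConjecture.HodgeConjecture.Cruxes.HLiu418.K2LiuDoubledUTwoTwoWeylCocycle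
open Summit.HodgeConjecture.HodgeConjecture.Cruxes.HLiu418.K2LiuDoubledUTwoTwoLevi
open Summit.HodgeConjecture.HodgeConjecture.Cruxes.HLiu418.K2LiuDoubledUTwoTwoFrameTransport
open Summit.HodgeConjecture.HodgeConjecture.Cruxes.HLiu418.K2LiuDoubledUTwoTwoUnipotentHaar
open Summit.HodgeConjecture.HodgeConjecture.Cruxes.HLiu418.K2LiuDoubledUTwoTwoLeviTransport
open Summit.HodgeConjecture.HodgeConjecture.Cruxes.HLiu418.K2LiuUnipDeltaRankOneCoordinates
open Summit.HodgeConjecture.HodgeConjecture.Cruxes.HLiu418.K2LiuSiegelCocycleLetters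
open Summit.HodgeConjecture.HodgeConjecture.Cruxes.HLiu418.K2LiuSiegelCocycleStageLetters
open Summit.HodgeConjecture.HodgeConjecture.Cruxes.HLiu418.K2LiuSiegelCocycleStageShort
open Summit.HodgeConjecture.HodgeConjecture.Cruxes.HLiu418.K2LiuSiegelCocycleChainShort
open Summit.HodgeConjecture.HodgeConjecture.Cruxes.HLiu418.K2LiuSiegelCocycleChainLong
open Summit.HodgeConjecture.HodgeConjecture.Cruxes.HLiu418.K2LiuSiegelIntertwiningCocycle
open Summit.HodgeConjecture.HodgeConjecture.Cruxes.HLiu418.K2LiuIteratedRankOneCocycle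
open Summit.HodgeConjecture.HodgeConjecture.Cruxes.HLiu418.K2LiuLocalRingPlaceDecomposition
open Summit.HodgeConjecture.HodgeConjecture.Cruxes.HLiu418.K2LiuA7NormalisedRegularitySetup
open Summit.HodgeConjecture.HodgeConjecture.Cruxes.HLiu418.K2LiuA7NormalisedRegularityMajorant
open Summit.HodgeConjecture.HodgeConjecture.Cruxes.HLiu418.K2LiuA7NormaliserAlgebra
open Summit.HodgeConjecture.HodgeConjecture.Cruxes.HLiu418.K2LiuRankOneSphericalStage
open Summit.HodgeConjecture.HodgeConjecture.Cruxes.HLiu418.K2LiuSiegelCocycleSphericalValue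

namespace Summit.HodgeConjecture.HodgeConjecture.Cruxes.HLiu418.K2LiuRankOneSingularLocalValue

variable (F : Type) [Field F] [NumberField F] (E : Type) [Field E] [NumberField E] [Algebra F E]
  [Algebra.IsQuadraticExtension F E] (c : E ≃ₐ[F] E)
  {δ : E} (hcδ : c δ = -δ) (hδ : δ ≠ 0) {d : F} (hd : δ * δ = algebraMap F E d) (v : HeightOneSpectrum (𝓞 F))
  {T₂ : Matrix (Fin 2) (Fin 2) F} (hT₂ : T₂.IsSymm) {J₂D : Matrix (Fin (2 + 2)) (Fin (2 + 2)) E} (hJ₂D : J₂D = (gramD F 2 T₂).map (algebraMap F E))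
  (D Dinv : Matrix (Fin 2) (Fin 2) F) (hDD : D * Dinv = 1) (hDD' : Dinv * D = 1) (Q : GL (Fin (2 + 2)) F)
  (hQm : (Q : Matrix (Fin (2 + 2)) (Fin (2 + 2)) F) = Matrix.reindex (e₂ 2) (e₂ 2) (Matrix.fromBlocks 1 D 1 (-D)))
  (hQ : (Q : Matrix (Fin (2 + 2)) (Fin (2 + 2)) F)ᵀ * gramD F 2 T₂ * (Q : Matrix (Fin (2 + 2)) (Fin (2 + 2)) F) = (StdForm.antidiagonal (2 + 2)).over F)

/-! ## §1 The raw value of the twisted cocycle on a spherical section -/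

include hcδ hδ hd hT₂ hDD hQm hQ in
set_option maxHeartbeats 400000 in -- as ★ (F-GK-2) §2 (the binder telescope of the chain; `whnf` > 200 000): structural `rw`∕`exact` only
/-- **THE TWISTED SIEGEL INTEGRAL OF A `K₀`-SPHERICAL SECTION, BY THE COCYCLE (non-split place, raw form).**  Let `χ_v` be unitary, `1 < re s`,
`f ∈ I_v(s, χ_v)` a smooth Siegel section right-invariant under an OPEN subgroup `K₀ ∋ h` containing the letters of the cocycle at integral points (as ★ p862057 §2);
`e` the cocycle coordinates of `N_Δ(F_v)` (★ B1b-2b: `e(b₁,z,b₂) = φ(n(ι(b₁)δ, z, ι(b₂)δ))`, additive-to-multiplicative), `μ_F` an additive Haar measure on `F_v`,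
`ψ` a continuous additive character of `F_v`, `τ ∈ F_v`, and `htw` the TWISTED RANK-ONE STAGE by value (constant `Tw`).  Then
**`∫ ψ((e⁻¹u)₁·τ) · f(w_Δ u h) dνN(u) = χ_s(m₀) · νN(BOX) · G₁ · G₂ · Tw · f(h)`**, `G₁ = 1 + C₁(1−q⁻¹)(α_F q^{1−(2s+2)})L_F(2s+1)`,
`G₂ = 1 + χ_w(−1)(1−q_w⁻¹)(α_N q_w^{1−(2s+1)})L_{E_w}(2s)` — the twist sits on the outermost variable of ★ B4d-3's iterated integral, so stages A and B are ★ p862057's.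
[cite: Casselman1980, §3 Thm. 3.1] [cite: KudlaRallis1994, §2] [cite: Shimura1997, §18.4] [cite: Tate1950, §2.5] -/
theorem integral_addChar_mul_eq_of_spherical_of_forall_eq
    [MeasurableSpace (v.adicCompletion F)] [BorelSpace (v.adicCompletion F)] (μF : Measure (v.adicCompletion F)) [μF.IsAddHaarMeasure]
    [MeasurableSpace (unipDeltaLocal F E c v 2 (JD := J₂D))] [BorelSpace (unipDeltaLocal F E c v 2 (JD := J₂D))]
    (e : (v.adicCompletion F × UnitaryGroup.LocalRing E v × v.adicCompletion F) ≃ₜ unipDeltaLocal F E c v 2 (JD := J₂D))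
    (he : ∀ b₁ z b₂, ((e (b₁, z, b₂) : unipDeltaLocal F E c v 2 (JD := J₂D)) : UnitaryGroup.localPi E c (2 + 2) J₂D v) = FrameTransport.frameConj F E c v (2 + 2) hJ₂D (antidiagonal_over_eq_map F E 2) Q hQ (toLocalFour F E c v (nSiegel (UnitaryGroup.LocalRing E v) (UnitaryGroup.conjLocal E c v) (UnitaryGroup.conjLocal_conjLocal c v hcδ hδ) (UnitaryGroup.toLocalRing E v b₁ * algebraMap E (UnitaryGroup.LocalRing E v) δ) (z) (UnitaryGroup.toLocalRing E v b₂ * algebraMap E (UnitaryGroup.LocalRing E v) δ) (conjLocal_coord F E c hcδ v b₁) (conjLocal_coord F E c hcδ v b₂))))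
    (headd : ∀ p p', e (p + p') = e p * e p')
    (νN : Measure (unipDeltaLocal F E c v 2 (JD := J₂D))) [νN.IsHaarMeasure]
    (χv : ∀ w : PlacesOver E v, (w.1.adicCompletion E)ˣ →* ℂˣ) (hχ : ∀ (w' : PlacesOver E v) (x : (w'.1.adicCompletion E)ˣ), ‖((χv w' x : ℂˣ) : ℂ)‖ = 1)
    (K₀ : Subgroup (UnitaryGroup.localPi E c (2 + 2) J₂D v)) (hK₀ : IsOpen (K₀ : Set (UnitaryGroup.localPi E c (2 + 2) J₂D v)))
    {s : ℂ} (hs : 1 < s.re) {f : UnitaryGroup.localPi E c (2 + 2) J₂D v → ℂ} (hSieg : IsLocalSiegelSection F E c hcδ hδ hd v 2 hT₂ hJ₂D χv s f) (hsm : IsSmooth F E c v 2 f)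
    (hfK : ∀ g, ∀ k ∈ K₀, f (g * k) = f g)
    (w : PlacesOver E v) (hw : ∀ w' : PlacesOver E v, w' = w)
    (A : GL (Fin 2) (UnitaryGroup.LocalRing E v)) (hA : A.val = !![1 - Pi.single w 1, Pi.single w 1; Pi.single w 1, 1 - Pi.single w 1])
    (hKw₂ : FrameTransport.frameConj F E c v (2 + 2) hJ₂D (antidiagonal_over_eq_map F E 2) Q hQ (toLocalFour F E c v (weylTwo (UnitaryGroup.LocalRing E v) (UnitaryGroup.conjLocal E c v))) ∈ K₀) (hKA : FrameTransport.frameConj F E c v (2 + 2) hJ₂D (antidiagonal_over_eq_map F E 2) Q hQ (toLocalFour F E c v (leviElt (UnitaryGroup.LocalRing E v) (UnitaryGroup.conjLocal E c v) (UnitaryGroup.conjLocal_conjLocal c v hcδ hδ) A)) ∈ K₀)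
    (hKu : ∀ t ∈ primePowBall (v.adicCompletion F) 0, FrameTransport.frameConj F E c v (2 + 2) hJ₂D (antidiagonal_over_eq_map F E 2) Q hQ (toLocalFour F E c v (uLongTwo (UnitaryGroup.LocalRing E v) (UnitaryGroup.conjLocal E c v) (UnitaryGroup.toLocalRing E v t * algebraMap E (UnitaryGroup.LocalRing E v) δ) (conjLocal_coord F E c hcδ v t))) ∈ K₀)
    (hKū : ∀ t ∈ primePowBall (v.adicCompletion F) 0, FrameTransport.frameConj F E c v (2 + 2) hJ₂D (antidiagonal_over_eq_map F E 2) Q hQ (toLocalFour F E c v (uLongTwo (UnitaryGroup.LocalRing E v) (UnitaryGroup.conjLocal E c v) (UnitaryGroup.toLocalRing E v t * algebraMap E (UnitaryGroup.LocalRing E v) δ⁻¹) (conjLocal_coord_inv F E c hcδ v t))) ∈ K₀)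
    (hKm : ∀ ζ ∈ primePowBall (w.1.adicCompletion E) 0, FrameTransport.frameConj F E c v (2 + 2) hJ₂D (antidiagonal_over_eq_map F E 2) Q hQ (toLocalFour F E c v (uMinus (UnitaryGroup.LocalRing E v) (UnitaryGroup.conjLocal E c v) (UnitaryGroup.conjLocal_conjLocal c v hcδ hδ) (Pi.single w ζ))) ∈ K₀)
    (h : UnitaryGroup.localPi E c (2 + 2) J₂D v) (hh : h ∈ K₀)
    (ψ : AddChar (v.adicCompletion F) Circle) (hψ : Continuous ψ) (τ : v.adicCompletion F) (Tw : ℂ)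
    (htw : ∀ Φ : UnitaryGroup.localPi E c (2 + 2) J₂D v → ℂ, (∀ g, ∀ k ∈ K₀, Φ (g * k) = Φ g) →
      (∀ (x : (v.adicCompletion F)ˣ) (g : UnitaryGroup.localPi E c (2 + 2) J₂D v),
        Φ (FrameTransport.frameConj F E c v (2 + 2) hJ₂D (antidiagonal_over_eq_map F E 2) Q hQ (toLocalFour F E c v (weylTwo (UnitaryGroup.LocalRing E v) (UnitaryGroup.conjLocal E c v))) * FrameTransport.frameConj F E c v (2 + 2) hJ₂D (antidiagonal_over_eq_map F E 2) Q hQ (toLocalFour F E c v (uLongTwo (UnitaryGroup.LocalRing E v) (UnitaryGroup.conjLocal E c v) (UnitaryGroup.toLocalRing E v (x : v.adicCompletion F) * algebraMap E (UnitaryGroup.LocalRing E v) δ) (conjLocal_coord F E c hcδ v (x : v.adicCompletion F)))) * g) =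
          (localSiegelCharacter F E c v 2 χv s (FrameTransport.frameConj F E c v (2 + 2) hJ₂D (antidiagonal_over_eq_map F E 2) Q hQ (toLocalFour F E c v (torusElt (UnitaryGroup.LocalRing E v) (UnitaryGroup.conjLocal E c v) (UnitaryGroup.conjLocal_conjLocal c v hcδ hδ) (-((Units.mk0 δ hδ).map (algebraMap E (UnitaryGroup.LocalRing E v) : E →* UnitaryGroup.LocalRing E v))⁻¹) (1)))) * ((∏ w' : PlacesOver E v, ‖algebraMap E (UnitaryGroup.LocalRing E v) δ w'‖ : ℝ) : ℂ)) * ((((chiF F E v χv) x)⁻¹ : ℂˣ) : ℂ) * ((normAbs (v.adicCompletion F) (x : v.adicCompletion F) : ℝ) : ℂ) ^ (-(2 * s)) *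
            Φ (FrameTransport.frameConj F E c v (2 + 2) hJ₂D (antidiagonal_over_eq_map F E 2) Q hQ (toLocalFour F E c v (weylTwo (UnitaryGroup.LocalRing E v) (UnitaryGroup.conjLocal E c v))) * FrameTransport.frameConj F E c v (2 + 2) hJ₂D (antidiagonal_over_eq_map F E 2) Q hQ (toLocalFour F E c v (uLongTwo (UnitaryGroup.LocalRing E v) (UnitaryGroup.conjLocal E c v) (UnitaryGroup.toLocalRing E v ((x⁻¹ : (v.adicCompletion F)ˣ) : v.adicCompletion F) * algebraMap E (UnitaryGroup.LocalRing E v) δ⁻¹) (conjLocal_coord_inv F E c hcδ v ((x⁻¹ : (v.adicCompletion F)ˣ) : v.adicCompletion F)))) * FrameTransport.frameConj F E c v (2 + 2) hJ₂D (antidiagonal_over_eq_map F E 2) Q hQ (toLocalFour F E c v (weylTwo (UnitaryGroup.LocalRing E v) (UnitaryGroup.conjLocal E c v))) * g)) →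
      Φ (FrameTransport.frameConj F E c v (2 + 2) hJ₂D (antidiagonal_over_eq_map F E 2) Q hQ (toLocalFour F E c v (weylTwo (UnitaryGroup.LocalRing E v) (UnitaryGroup.conjLocal E c v))) * h) = Φ h →
      Integrable (fun x : v.adicCompletion F => (((ψ (x * τ) : Circle) : ℂ)) * Φ (FrameTransport.frameConj F E c v (2 + 2) hJ₂D (antidiagonal_over_eq_map F E 2) Q hQ (toLocalFour F E c v (weylTwo (UnitaryGroup.LocalRing E v) (UnitaryGroup.conjLocal E c v))) * FrameTransport.frameConj F E c v (2 + 2) hJ₂D (antidiagonal_over_eq_map F E 2) Q hQ (toLocalFour F E c v (uLongTwo (UnitaryGroup.LocalRing E v) (UnitaryGroup.conjLocal E c v) (UnitaryGroup.toLocalRing E v x * algebraMap E (UnitaryGroup.LocalRing E v) δ) (conjLocal_coord F E c hcδ v x))) * h)) μF ∧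
        ∫ x, (((ψ (x * τ) : Circle) : ℂ)) * Φ (FrameTransport.frameConj F E c v (2 + 2) hJ₂D (antidiagonal_over_eq_map F E 2) Q hQ (toLocalFour F E c v (weylTwo (UnitaryGroup.LocalRing E v) (UnitaryGroup.conjLocal E c v))) * FrameTransport.frameConj F E c v (2 + 2) hJ₂D (antidiagonal_over_eq_map F E 2) Q hQ (toLocalFour F E c v (uLongTwo (UnitaryGroup.LocalRing E v) (UnitaryGroup.conjLocal E c v) (UnitaryGroup.toLocalRing E v x * algebraMap E (UnitaryGroup.LocalRing E v) δ) (conjLocal_coord F E c hcδ v x))) * h) ∂μF = (μF.real (primePowBall (v.adicCompletion F) 0) : ℂ) * Tw * Φ h) :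
    ∫ u, (((ψ ((e.symm u).1 * τ) : Circle) : ℂ)) * f (weylDelta F E c v 2 hJ₂D (T₀ := T₂) * (u : UnitaryGroup.localPi E c (2 + 2) J₂D v) * h) ∂νN =
      localSiegelCharacter F E c v 2 χv s (weylDelta F E c v 2 hJ₂D (T₀ := T₂) * FrameTransport.frameConj F E c v (2 + 2) hJ₂D (antidiagonal_over_eq_map F E 2) Q hQ (toLocalFour F E c v (weylSiegel (UnitaryGroup.LocalRing E v) (UnitaryGroup.conjLocal E c v)))) * (νN.real {u : unipDeltaLocal F E c v 2 (JD := J₂D) | ∃ b₁ ∈ primePowBall (v.adicCompletion F) 0, ∃ ζ ∈ primePowBall (w.1.adicCompletion E) 0, ∃ b₂ ∈ primePowBall (v.adicCompletion F) 0, (u : UnitaryGroup.localPi E c (2 + 2) J₂D v) = FrameTransport.frameConj F E c v (2 + 2) hJ₂D (antidiagonal_over_eq_map F E 2) Q hQ (toLocalFour F E c v (nSiegel (UnitaryGroup.LocalRing E v) (UnitaryGroup.conjLocal E c v) (UnitaryGroup.conjLocal_conjLocal c v hcδ hδ) (UnitaryGroup.toLocalRing E v b₁ * algebraMap E (UnitaryGroup.LocalRing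 E v) δ) (Pi.single w ζ) (UnitaryGroup.toLocalRing E v b₂ * algebraMap E (UnitaryGroup.LocalRing E v) δ) (conjLocal_coord F E c hcδ v b₁) (conjLocal_coord F E c hcδ v b₂)))} : ℂ) *
        ((1 + localSiegelCharacter F E c v 2 χv s (FrameTransport.frameConj F E c v (2 + 2) hJ₂D (antidiagonal_over_eq_map F E 2) Q hQ (toLocalFour F E c v (torusElt (UnitaryGroup.LocalRing E v) (UnitaryGroup.conjLocal E c v) (UnitaryGroup.conjLocal_conjLocal c v hcδ hδ) (1) (-((Units.mk0 δ hδ).map (algebraMap E (UnitaryGroup.LocalRing E v) : E →* UnitaryGroup.LocalRing E v))⁻¹)))) * (1 - (residueFieldCard (v.adicCompletion F) : ℂ)⁻¹) * (unramValue F v (chiF F E v χv) * (residueFieldCard (v.adicCompletion F) : ℂ) ^ (1 - (2 * s + 2))) * lFactor F v (chiF F E v χv) ((2 * s + 2) - 1)) *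
          (1 + ((χv w (-1) : ℂˣ) : ℂ) * (1 - (residueFieldCard (w.1.adicCompletion E) : ℂ)⁻¹) * (unramValue E w.1 (chiNorm F E c v χv w) * (residueFieldCard (w.1.adicCompletion E) : ℂ) ^ (1 - (2 * s + 1))) * lFactor E w.1 (chiNorm F E c v χv w) ((2 * s + 1) - 1)) * Tw) * f h := by
  -- topology and measures on `E_w`, `E ⊗ F_v` (as in ★ B7 ∕ ★ p862057; `F_v` carries the given Borel structure)
  haveI := secondCountableTopology_adicCompletion F v
  haveI : ∀ w' : PlacesOver E v, SecondCountableTopology (w'.1.adicCompletion E) := fun w' => secondCountableTopology_adicCompletion E w'.1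
  borelize (w.1.adicCompletion E) (UnitaryGroup.LocalRing E v)
  obtain ⟨μw, hμw⟩ : ∃ μ : Measure (w.1.adicCompletion E), μ.IsAddHaarMeasure := ⟨Measure.addHaar, inferInstance⟩
  obtain ⟨e₁, he₁, he₁add⟩ := exists_homeomorph_single_of_forall_eq F E v w hw
  have hmap : Measure.map (⇑e₁) μw = Measure.map (⇑e₁.toMeasurableEquiv) μw := by rw [Homeomorph.toMeasurableEquiv_coe]
  haveI hμR : (Measure.map (⇑e₁) μw).IsAddHaarMeasure :=
    AddEquiv.isAddHaarMeasure_map μw ({ toFun := e₁, invFun := e₁.symm, left_inv := e₁.symm_apply_apply, right_inv := e₁.apply_symm_apply, map_add' := he₁add } :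
      w.1.adicCompletion E ≃+ UnitaryGroup.LocalRing E v) e₁.continuous e₁.symm.continuous
  have hμRint : ∀ G : UnitaryGroup.LocalRing E v → ℂ, ∫ z, G z ∂(Measure.map (⇑e₁) μw) = ∫ ζ, G (Pi.single w ζ) ∂μw := fun G => by
    rw [hmap, integral_map_equiv]; simp only [Homeomorph.toMeasurableEquiv_coe, he₁]
  -- the Haar relation in the given coordinates
  obtain ⟨cN, hcN, hν⟩ := exists_measure_eq_smul_map F E c v e headd νN μF (Measure.map (⇑e₁) μw)
  -- `K₀` as an open subgroup
  obtain ⟨K', hK'⟩ : ∃ K' : OpenSubgroup (UnitaryGroup.localPi E c (2 + 2) J₂D v), (K' : Subgroup (UnitaryGroup.localPi E c (2 + 2) J₂D v)) = K₀ := ⟨⟨K₀, hK₀⟩, rfl⟩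
  have hfK' : ∀ g, ∀ k ∈ (K' : Subgroup (UnitaryGroup.localPi E c (2 + 2) J₂D v)), f (g * k) = f g := by rw [hK']; exact hfK
  -- the letters
  have huBadd : ∀ ζ ζ' : w.1.adicCompletion E, FrameTransport.frameConj F E c v (2 + 2) hJ₂D (antidiagonal_over_eq_map F E 2) Q hQ (toLocalFour F E c v (uMinus (UnitaryGroup.LocalRing E v) (UnitaryGroup.conjLocal E c v) (UnitaryGroup.conjLocal_conjLocal c v hcδ hδ) (Pi.single w (ζ + ζ')))) = FrameTransport.frameConj F E c v (2 + 2) hJ₂D (antidiagonal_over_eq_map F E 2) Q hQ (toLocalFour F E c v (uMinus (UnitaryGroup.LocalRing E v) (UnitaryGroup.conjLocal E c v) (UnitaryGroup.conjLocal_conjLocal c v hcδ hδ) (Pi.single w ζ))) * FrameTransport.frameConj F E c v (2 + 2) hJ₂D (antidiagonal_over_eq_map F E 2) Q hQ (toLocalFour F E c v (uMinus (UnitaryGroup.LocalRing E v) (UnitaryGroup.conjLocal E c v) (UnitaryGroup.conjLocal_conjLocal c v hcδ hδ) (Pi.single w ζ'))) :=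
    fun ζ ζ' => by
      rw [show uMinus (UnitaryGroup.LocalRing E v) (UnitaryGroup.conjLocal E c v) (UnitaryGroup.conjLocal_conjLocal c v hcδ hδ) (Pi.single w (ζ + ζ')) =
          uMinus (UnitaryGroup.LocalRing E v) (UnitaryGroup.conjLocal E c v) (UnitaryGroup.conjLocal_conjLocal c v hcδ hδ) (Pi.single w ζ) * uMinus (UnitaryGroup.LocalRing E v) (UnitaryGroup.conjLocal E c v) (UnitaryGroup.conjLocal_conjLocal c v hcδ hδ) (Pi.single w ζ') by
        rw [uMinus_mul, ← Pi.single_add], map_mul, map_mul]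
  have hmid : ∀ (ζ : w.1.adicCompletion E) (g : UnitaryGroup.localPi E c (2 + 2) J₂D v), FrameTransport.frameConj F E c v (2 + 2) hJ₂D (antidiagonal_over_eq_map F E 2) Q hQ (toLocalFour F E c v (weylOne (UnitaryGroup.LocalRing E v) (UnitaryGroup.conjLocal E c v))) * FrameTransport.frameConj F E c v (2 + 2) hJ₂D (antidiagonal_over_eq_map F E 2) Q hQ (toLocalFour F E c v (uMinus (UnitaryGroup.LocalRing E v) (UnitaryGroup.conjLocal E c v) (UnitaryGroup.conjLocal_conjLocal c v hcδ hδ) (Pi.single w ζ))) * g = FrameTransport.frameConj F E c v (2 + 2) hJ₂D (antidiagonal_over_eq_map F E 2) Q hQ (toLocalFour F E c v (leviElt (UnitaryGroup.LocalRing E v) (UnitaryGroup.conjLocal E c v) (UnitaryGroup.conjLocal_conjLocal c v hcδ hδ) A)) * FrameTransport.frameConj F E c v (2 + 2) hJ₂D (antidiagonal_over_eq_map F E 2) Q hQ (toLocalFour F E c v (uMinus (UnitaryGroup.LocalRing E v) (UnitaryGroup.conjLocal E c v) (UnitaryGroup.conjLocal_conjLocal c v hcδ hδ) (Pi.single w ζ)))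 * g := by
    intro ζ g
    rw [← frameConj_partialWeyl_mul_uMinus_of_forall_eq F E c hcδ hδ v hJ₂D Q hQ hw A hA (Pi.single w ζ), Pi.single_eq_same]
  -- the point `h`: levels `0` and the Weyl letters drop out
  have hval : ∀ (Φ : UnitaryGroup.localPi E c (2 + 2) J₂D v → ℂ), (∀ g, ∀ k ∈ K₀, Φ (g * k) = Φ g) → ∀ k, k ∈ K₀ → Φ (k * h) = Φ h := by
    intro Φ hΦ k hk
    have h1 : Φ (k * h) = Φ 1 := by simpa using hΦ 1 (k * h) (K₀.mul_mem hk hh)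
    have h2 : Φ h = Φ 1 := by simpa using hΦ 1 h hh
    exact h1.trans h2.symm
  have hlev : ∀ k, k ∈ K₀ → h⁻¹ * k * h ∈ K₀ := fun k hk => K₀.mul_mem (K₀.mul_mem (K₀.inv_mem hh) hk) hh
  have hmuA : ∀ t ∈ primePowBall (v.adicCompletion F) 0, h⁻¹ * FrameTransport.frameConj F E c v (2 + 2) hJ₂D (antidiagonal_over_eq_map F E 2) Q hQ (toLocalFour F E c v (uLongTwo (UnitaryGroup.LocalRing E v) (UnitaryGroup.conjLocal E c v) (UnitaryGroup.toLocalRing E v t * algebraMap E (UnitaryGroup.LocalRing E v) δ) (conjLocal_coord F E c hcδ v t))) * h ∈ K₀ := fun t ht => hlev _ (hKu t ht)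
  have hmūA : ∀ t ∈ primePowBall (v.adicCompletion F) 0, h⁻¹ * (FrameTransport.frameConj F E c v (2 + 2) hJ₂D (antidiagonal_over_eq_map F E 2) Q hQ (toLocalFour F E c v (weylTwo (UnitaryGroup.LocalRing E v) (UnitaryGroup.conjLocal E c v))) * FrameTransport.frameConj F E c v (2 + 2) hJ₂D (antidiagonal_over_eq_map F E 2) Q hQ (toLocalFour F E c v (uLongTwo (UnitaryGroup.LocalRing E v) (UnitaryGroup.conjLocal E c v) (UnitaryGroup.toLocalRing E v t * algebraMap E (UnitaryGroup.LocalRing E v) δ⁻¹) (conjLocal_coord_inv F E c hcδ v t))) * FrameTransport.frameConj F E c v (2 + 2) hJ₂D (antidiagonal_over_eq_map F E 2) Q hQ (toLocalFour F E c v (weylTwo (UnitaryGroup.LocalRing E v) (UnitaryGroup.conjLocal E c v)))) * h ∈ K₀ :=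
    fun t ht => hlev _ (K₀.mul_mem (K₀.mul_mem hKw₂ (hKū t ht)) hKw₂)
  have hmuB : ∀ ζ ∈ primePowBall (w.1.adicCompletion E) 0, h⁻¹ * FrameTransport.frameConj F E c v (2 + 2) hJ₂D (antidiagonal_over_eq_map F E 2) Q hQ (toLocalFour F E c v (uMinus (UnitaryGroup.LocalRing E v) (UnitaryGroup.conjLocal E c v) (UnitaryGroup.conjLocal_conjLocal c v hcδ hδ) (Pi.single w ζ))) * h ∈ K₀ := fun ζ hζ => hlev _ (hKm ζ hζ)
  have hmūB : ∀ ζ ∈ primePowBall (w.1.adicCompletion E) 0, h⁻¹ * (FrameTransport.frameConj F E c v (2 + 2) hJ₂D (antidiagonal_over_eq_map F E 2) Q hQ (toLocalFour F E c v (leviElt (UnitaryGroup.LocalRing E v) (UnitaryGroup.conjLocal E c v) (UnitaryGroup.conjLocal_conjLocal c v hcδ hδ) A)) * FrameTransport.frameConj F E c v (2 + 2) hJ₂D (antidiagonal_over_eq_map F E 2) Q hQ (toLocalFour F E c v (uMinus (UnitaryGroup.LocalRing E v) (UnitaryGroup.conjLocal E c v) (UnitaryGroup.conjLocal_conjLocal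 c v hcδ hδ) (Pi.single w ζ))) * FrameTransport.frameConj F E c v (2 + 2) hJ₂D (antidiagonal_over_eq_map F E 2) Q hQ (toLocalFour F E c v (leviElt (UnitaryGroup.LocalRing E v) (UnitaryGroup.conjLocal E c v) (UnitaryGroup.conjLocal_conjLocal c v hcδ hδ) A))) * h ∈ K₀ :=
    fun ζ hζ => hlev _ (K₀.mul_mem (K₀.mul_mem hKA (hKm ζ hζ)) hKA)
  -- STAGE A: `𝒜f`, datum `(χ_s(φ t(1,−δ⁻¹)), χ_F, 2s+2)` (untwisted, ★ p862057)
  obtain ⟨N₁, hN₁⟩ : ∃ N₁ : UnitaryGroup.localPi E c (2 + 2) J₂D v → ℂ, N₁ = fun g => ∫ y, f (FrameTransport.frameConj F E c v (2 + 2) hJ₂D (antidiagonal_over_eq_map F E 2) Q hQ (toLocalFour F E c v (weylTwo (UnitaryGroup.LocalRing E v) (UnitaryGroup.conjLocal E c v))) * FrameTransport.frameConj F E c v (2 + 2) hJ₂D (antidiagonal_over_eq_map F E 2) Q hQ (toLocalFour F E c v (uLongTwo (UnitaryGroup.LocalRing E v) (UnitaryGroup.conjLocal E c v) (UnitaryGroup.toLocalRing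 E v y * algebraMap E (UnitaryGroup.LocalRing E v) δ) (conjLocal_coord F E c hcδ v y))) * g) ∂μF := ⟨_, rfl⟩
  have hN₁eq : ∀ g, N₁ g = 1 * ∫ y, f (FrameTransport.frameConj F E c v (2 + 2) hJ₂D (antidiagonal_over_eq_map F E 2) Q hQ (toLocalFour F E c v (weylTwo (UnitaryGroup.LocalRing E v) (UnitaryGroup.conjLocal E c v))) * FrameTransport.frameConj F E c v (2 + 2) hJ₂D (antidiagonal_over_eq_map F E 2) Q hQ (toLocalFour F E c v (uLongTwo (UnitaryGroup.LocalRing E v) (UnitaryGroup.conjLocal E c v) (UnitaryGroup.toLocalRing E v y * algebraMap E (UnitaryGroup.LocalRing E v) δ) (conjLocal_coord F E c hcδ v y))) * g) ∂μF := fun g => by rw [hN₁, one_mul]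
  have hN₁K : ∀ g, ∀ k ∈ K₀, N₁ (g * k) = N₁ g := fun g k hk => by
    rw [hN₁]
    exact integral_congr_ae (Filter.Eventually.of_forall fun y => by simp only [← mul_assoc]; exact hfK _ k hk)
  have heA : 1 < (2 * s + 2).re := by simp; linarith
  have stageA : ∫ y, f (FrameTransport.frameConj F E c v (2 + 2) hJ₂D (antidiagonal_over_eq_map F E 2) Q hQ (toLocalFour F E c v (weylTwo (UnitaryGroup.LocalRing E v) (UnitaryGroup.conjLocal E c v))) * FrameTransport.frameConj F E c v (2 + 2) hJ₂D (antidiagonal_over_eq_map F E 2) Q hQ (toLocalFour F E c v (uLongTwo (UnitaryGroup.LocalRing E v) (UnitaryGroup.conjLocal E c v) (UnitaryGroup.toLocalRing E v y * algebraMap E (UnitaryGroup.LocalRing E v) δ) (conjLocal_coord F E c hcδ v y))) * h) ∂μF =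
      (μF.real (primePowBall (v.adicCompletion F) 0) : ℂ) * (1 + localSiegelCharacter F E c v 2 χv s (FrameTransport.frameConj F E c v (2 + 2) hJ₂D (antidiagonal_over_eq_map F E 2) Q hQ (toLocalFour F E c v (torusElt (UnitaryGroup.LocalRing E v) (UnitaryGroup.conjLocal E c v) (UnitaryGroup.conjLocal_conjLocal c v hcδ hδ) (1) (-((Units.mk0 δ hδ).map (algebraMap E (UnitaryGroup.LocalRing E v) : E →* UnitaryGroup.LocalRing E v))⁻¹)))) * (1 - (residueFieldCard (v.adicCompletion F) : ℂ)⁻¹) * (unramValue F v (chiF F E v χv) * (residueFieldCard (v.adicCompletion F) : ℂ) ^ (1 - (2 * s + 2))) * lFactor F v (chiF F E v χv) ((2 * s + 2) - 1)) * f h :=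
    (integrable_and_integral_eq_of_level_zero μF hfK
      (u := fun y => FrameTransport.frameConj F E c v (2 + 2) hJ₂D (antidiagonal_over_eq_map F E 2) Q hQ (toLocalFour F E c v (uLongTwo (UnitaryGroup.LocalRing E v) (UnitaryGroup.conjLocal E c v) (UnitaryGroup.toLocalRing E v y * algebraMap E (UnitaryGroup.LocalRing E v) δ) (conjLocal_coord F E c hcδ v y))))
      (ū := fun t => FrameTransport.frameConj F E c v (2 + 2) hJ₂D (antidiagonal_over_eq_map F E 2) Q hQ (toLocalFour F E c v (weylTwo (UnitaryGroup.LocalRing E v) (UnitaryGroup.conjLocal E c v))) * FrameTransport.frameConj F E c v (2 + 2) hJ₂D (antidiagonal_over_eq_map F E 2) Q hQ (toLocalFour F E c v (uLongTwo (UnitaryGroup.LocalRing E v) (UnitaryGroup.conjLocal E c v) (UnitaryGroup.toLocalRing E v t * algebraMap E (UnitaryGroup.LocalRing E v) δ⁻¹) (conjLocal_coord_inv F E c hcδ v t))) * FrameTransport.frameConj F E c v (2 + 2) hJ₂D (antidiagonal_over_eq_map F E 2) Q hQ (toLocalFour F E c v (weylTwo (UnitaryGroup.LocalRing E v) (UnitaryGroup.conjLocal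 E c v))))
      (frameConj_uLongTwo_coord_add F E c hcδ v hJ₂D Q hQ) (FrameTransport.frameConj F E c v (2 + 2) hJ₂D (antidiagonal_over_eq_map F E 2) Q hQ (toLocalFour F E c v (weylTwo (UnitaryGroup.LocalRing E v) (UnitaryGroup.conjLocal E c v)))) (chiF F E v χv) (norm_chiF_eq_one (F := F) (E := E) hχ) (2 * s + 2) _ heA
      (fun x g => by simpa only using apply_weylTwo_uLongTwo_coord_of_isLocalSiegelSection F E c hcδ hδ hd v hT₂ hJ₂D D Dinv hDD Q hQm hQ χv s hSieg x g)
      h hmuA hmūA (hval f hfK _ hKw₂)).2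
  -- STAGE B: `ℬ_w 𝒜f`, datum `(χ_w(−1), χ_F∘N, 2s+1)` (untwisted, ★ p862057)
  obtain ⟨N₂, hN₂⟩ : ∃ N₂ : UnitaryGroup.localPi E c (2 + 2) J₂D v → ℂ, N₂ = fun g => ∫ ζ, N₁ (FrameTransport.frameConj F E c v (2 + 2) hJ₂D (antidiagonal_over_eq_map F E 2) Q hQ (toLocalFour F E c v (leviElt (UnitaryGroup.LocalRing E v) (UnitaryGroup.conjLocal E c v) (UnitaryGroup.conjLocal_conjLocal c v hcδ hδ) A)) * FrameTransport.frameConj F E c v (2 + 2) hJ₂D (antidiagonal_over_eq_map F E 2) Q hQ (toLocalFour F E c v (uMinus (UnitaryGroup.LocalRing E v) (UnitaryGroup.conjLocal E c v) (UnitaryGroup.conjLocal_conjLocal c v hcδ hδ) (Pi.single w ζ))) * g) ∂μw := ⟨_, rfl⟩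
  have hN₂eq : ∀ g, N₂ g = 1 * ∫ ζ, N₁ (FrameTransport.frameConj F E c v (2 + 2) hJ₂D (antidiagonal_over_eq_map F E 2) Q hQ (toLocalFour F E c v (leviElt (UnitaryGroup.LocalRing E v) (UnitaryGroup.conjLocal E c v) (UnitaryGroup.conjLocal_conjLocal c v hcδ hδ) A)) * FrameTransport.frameConj F E c v (2 + 2) hJ₂D (antidiagonal_over_eq_map F E 2) Q hQ (toLocalFour F E c v (uMinus (UnitaryGroup.LocalRing E v) (UnitaryGroup.conjLocal E c v) (UnitaryGroup.conjLocal_conjLocal c v hcδ hδ) (Pi.single w ζ))) * g) ∂μw := fun g => by rw [hN₂, one_mul]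
  have hN₂K : ∀ g, ∀ k ∈ K₀, N₂ (g * k) = N₂ g := fun g k hk => by
    rw [hN₂]
    exact integral_congr_ae (Filter.Eventually.of_forall fun ζ => by simp only [← mul_assoc]; exact hN₁K _ k hk)
  have heB : 1 < (2 * s + 1).re := by simp; linarith
  have stageB : ∫ ζ, N₁ (FrameTransport.frameConj F E c v (2 + 2) hJ₂D (antidiagonal_over_eq_map F E 2) Q hQ (toLocalFour F E c v (leviElt (UnitaryGroup.LocalRing E v) (UnitaryGroup.conjLocal E c v) (UnitaryGroup.conjLocal_conjLocal c v hcδ hδ) A)) * FrameTransport.frameConj F E c v (2 + 2) hJ₂D (antidiagonal_over_eq_map F E 2) Q hQ (toLocalFour F E c v (uMinus (UnitaryGroup.LocalRing E v) (UnitaryGroup.conjLocal E c v) (UnitaryGroup.conjLocal_conjLocal c v hcδ hδ) (Pi.single w ζ))) * h) ∂μw =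
      (μw.real (primePowBall (w.1.adicCompletion E) 0) : ℂ) * (1 + ((χv w (-1) : ℂˣ) : ℂ) * (1 - (residueFieldCard (w.1.adicCompletion E) : ℂ)⁻¹) * (unramValue E w.1 (chiNorm F E c v χv w) * (residueFieldCard (w.1.adicCompletion E) : ℂ) ^ (1 - (2 * s + 1))) * lFactor E w.1 (chiNorm F E c v χv w) ((2 * s + 1) - 1)) * N₁ h :=
    (integrable_and_integral_eq_of_level_zero μw hN₁K
      (u := fun ζ => FrameTransport.frameConj F E c v (2 + 2) hJ₂D (antidiagonal_over_eq_map F E 2) Q hQ (toLocalFour F E c v (uMinus (UnitaryGroup.LocalRing E v) (UnitaryGroup.conjLocal E c v) (UnitaryGroup.conjLocal_conjLocal c v hcδ hδ) (Pi.single w ζ))))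
      (ū := fun ζ => FrameTransport.frameConj F E c v (2 + 2) hJ₂D (antidiagonal_over_eq_map F E 2) Q hQ (toLocalFour F E c v (leviElt (UnitaryGroup.LocalRing E v) (UnitaryGroup.conjLocal E c v) (UnitaryGroup.conjLocal_conjLocal c v hcδ hδ) A)) * FrameTransport.frameConj F E c v (2 + 2) hJ₂D (antidiagonal_over_eq_map F E 2) Q hQ (toLocalFour F E c v (uMinus (UnitaryGroup.LocalRing E v) (UnitaryGroup.conjLocal E c v) (UnitaryGroup.conjLocal_conjLocal c v hcδ hδ) (Pi.single w ζ))) * FrameTransport.frameConj F E c v (2 + 2) hJ₂D (antidiagonal_over_eq_map F E 2) Q hQ (toLocalFour F E c v (leviElt (UnitaryGroup.LocalRing E v) (UnitaryGroup.conjLocal E c v) (UnitaryGroup.conjLocal_conjLocal c v hcδ hδ) A)))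
      huBadd (FrameTransport.frameConj F E c v (2 + 2) hJ₂D (antidiagonal_over_eq_map F E 2) Q hQ (toLocalFour F E c v (leviElt (UnitaryGroup.LocalRing E v) (UnitaryGroup.conjLocal E c v) (UnitaryGroup.conjLocal_conjLocal c v hcδ hδ) A))) (chiNorm F E c v χv w) (norm_chiNorm_eq_one (F := F) (E := E) (c := c) hχ w) (2 * s + 1) _ heB
      (fun x g => by simpa only using hrel_short F E c hcδ hδ hd v hT₂ hJ₂D D Dinv hDD Q hQm hQ μF χv s hSieg 1 hN₁eq w A hA x g)
      h hmuB hmūB (hval N₁ hN₁K _ hKA)).2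
  -- STAGE C, TWISTED: the by-value letter `htw` at `Φ := ℬ_w 𝒜 f` (its stage relation is ★ `hrel_long_of_forall_eq`)
  have hrelC : ∀ (x : (v.adicCompletion F)ˣ) (g : UnitaryGroup.localPi E c (2 + 2) J₂D v),
      N₂ (FrameTransport.frameConj F E c v (2 + 2) hJ₂D (antidiagonal_over_eq_map F E 2) Q hQ (toLocalFour F E c v (weylTwo (UnitaryGroup.LocalRing E v) (UnitaryGroup.conjLocal E c v))) * FrameTransport.frameConj F E c v (2 + 2) hJ₂D (antidiagonal_over_eq_map F E 2) Q hQ (toLocalFour F E c v (uLongTwo (UnitaryGroup.LocalRing E v) (UnitaryGroup.conjLocal E c v) (UnitaryGroup.toLocalRing E v (x : v.adicCompletion F) * algebraMap E (UnitaryGroup.LocalRing E v) δ) (conjLocal_coord F E c hcδ v (x : v.adicCompletion F)))) * g) =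
        (localSiegelCharacter F E c v 2 χv s (FrameTransport.frameConj F E c v (2 + 2) hJ₂D (antidiagonal_over_eq_map F E 2) Q hQ (toLocalFour F E c v (torusElt (UnitaryGroup.LocalRing E v) (UnitaryGroup.conjLocal E c v) (UnitaryGroup.conjLocal_conjLocal c v hcδ hδ) (-((Units.mk0 δ hδ).map (algebraMap E (UnitaryGroup.LocalRing E v) : E →* UnitaryGroup.LocalRing E v))⁻¹) (1)))) * ((∏ w' : PlacesOver E v, ‖algebraMap E (UnitaryGroup.LocalRing E v) δ w'‖ : ℝ) : ℂ)) * ((((chiF F E v χv) x)⁻¹ : ℂˣ) : ℂ) * ((normAbs (v.adicCompletion F) (x : v.adicCompletion F) : ℝ) : ℂ) ^ (-(2 * s)) *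
          N₂ (FrameTransport.frameConj F E c v (2 + 2) hJ₂D (antidiagonal_over_eq_map F E 2) Q hQ (toLocalFour F E c v (weylTwo (UnitaryGroup.LocalRing E v) (UnitaryGroup.conjLocal E c v))) * FrameTransport.frameConj F E c v (2 + 2) hJ₂D (antidiagonal_over_eq_map F E 2) Q hQ (toLocalFour F E c v (uLongTwo (UnitaryGroup.LocalRing E v) (UnitaryGroup.conjLocal E c v) (UnitaryGroup.toLocalRing E v ((x⁻¹ : (v.adicCompletion F)ˣ) : v.adicCompletion F) * algebraMap E (UnitaryGroup.LocalRing E v) δ⁻¹) (conjLocal_coord_inv F E c hcδ v ((x⁻¹ : (v.adicCompletion F)ˣ) : v.adicCompletion F)))) * FrameTransport.frameConj F E c v (2 + 2) hJ₂D (antidiagonal_over_eq_map F E 2) Q hQ (toLocalFour F E c v (weylTwo (UnitaryGroup.LocalRing E v) (UnitaryGroup.conjLocal E c v))) * g) := fun x g => by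
    rw [hrel_long_of_forall_eq F E c hcδ hδ hd v hT₂ hJ₂D D Dinv hDD Q hQm hQ μF χv s hSieg 1 hN₁eq w hw μw A hA 1 hN₂eq x g]
    ring
  have stageC : ∫ x, (((ψ (x * τ) : Circle) : ℂ)) * N₂ (FrameTransport.frameConj F E c v (2 + 2) hJ₂D (antidiagonal_over_eq_map F E 2) Q hQ (toLocalFour F E c v (weylTwo (UnitaryGroup.LocalRing E v) (UnitaryGroup.conjLocal E c v))) * FrameTransport.frameConj F E c v (2 + 2) hJ₂D (antidiagonal_over_eq_map F E 2) Q hQ (toLocalFour F E c v (uLongTwo (UnitaryGroup.LocalRing E v) (UnitaryGroup.conjLocal E c v) (UnitaryGroup.toLocalRing E v x * algebraMap E (UnitaryGroup.LocalRing E v) δ) (conjLocal_coord F E c hcδ v x))) * h) ∂μF =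
      (μF.real (primePowBall (v.adicCompletion F) 0) : ℂ) * Tw * N₂ h :=
    (htw N₂ hN₂K hrelC (hval N₂ hN₂K _ hKw₂)).2
  -- the Levi shift `w_Δ = m₀ φ(w_Δ^J)` under the twisted integral (pointwise, as ★ B4d-3 §1)
  have hshift : ∀ u : unipDeltaLocal F E c v 2 (JD := J₂D), (((ψ ((e.symm u).1 * τ) : Circle) : ℂ)) * f (weylDelta F E c v 2 hJ₂D (T₀ := T₂) * (u : UnitaryGroup.localPi E c (2 + 2) J₂D v) * h) =
      localSiegelCharacter F E c v 2 χv s (weylDelta F E c v 2 hJ₂D (T₀ := T₂) * FrameTransport.frameConj F E c v (2 + 2) hJ₂D (antidiagonal_over_eq_map F E 2) Q hQ (toLocalFour F E c v (weylSiegel (UnitaryGroup.LocalRing E v) (UnitaryGroup.conjLocal E c v)))) * ((((ψ ((e.symm u).1 * τ) : Circle) : ℂ)) * f (FrameTransport.frameConj F E c v (2 + 2) hJ₂D (antidiagonal_over_eq_map F E 2) Q hQ (toLocalFour F E c v (weylSiegel (UnitaryGroup.LocalRing E v) (UnitaryGroup.conjLocal E c v))) * (u : UnitaryGroup.localPi E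 c (2 + 2) J₂D v) * h)) := fun u => by
    conv_lhs => rw [weylDelta_eq_mul_frameConj_weylSiegel F E c v hJ₂D Q hQ]
    rw [mul_assoc (weylDelta F E c v 2 hJ₂D * FrameTransport.frameConj F E c v (2 + 2) hJ₂D (antidiagonal_over_eq_map F E 2) Q hQ (toLocalFour F E c v (weylSiegel (UnitaryGroup.LocalRing E v) (UnitaryGroup.conjLocal E c v)))), mul_assoc (weylDelta F E c v 2 hJ₂D * FrameTransport.frameConj F E c v (2 + 2) hJ₂D (antidiagonal_over_eq_map F E 2) Q hQ (toLocalFour F E c v (weylSiegel (UnitaryGroup.LocalRing E v) (UnitaryGroup.conjLocal E c v)))),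
      hSieg _ (isSiegelDelta_weylDelta_mul_frameConj_weylSiegel F E c hcδ hδ hd v hT₂ hJ₂D D Dinv hDD Q hQm hQ), ← mul_assoc]
    ring
  simp_rw [hshift]
  rw [integral_const_mul]
  -- fold the letters of the word
  obtain ⟨Aw, hAw⟩ : ∃ Aw : v.adicCompletion F → UnitaryGroup.localPi E c (2 + 2) J₂D v, Aw = fun y => FrameTransport.frameConj F E c v (2 + 2) hJ₂D (antidiagonal_over_eq_map F E 2) Q hQ (toLocalFour F E c v (weylTwo (UnitaryGroup.LocalRing E v) (UnitaryGroup.conjLocal E c v))) * FrameTransport.frameConj F E c v (2 + 2) hJ₂D (antidiagonal_over_eq_map F E 2) Q hQ (toLocalFour F E c v (uLongTwo (UnitaryGroup.LocalRing E v) (UnitaryGroup.conjLocal E c v) (UnitaryGroup.toLocalRing E v y * algebraMap E (UnitaryGroup.LocalRing E v) δ) (conjLocal_coord F E c hcδ v y))) := ⟨_, rfl⟩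
  obtain ⟨Bw, hBw⟩ : ∃ Bw : UnitaryGroup.LocalRing E v → UnitaryGroup.localPi E c (2 + 2) J₂D v, Bw = fun z => FrameTransport.frameConj F E c v (2 + 2) hJ₂D (antidiagonal_over_eq_map F E 2) Q hQ (toLocalFour F E c v (weylOne (UnitaryGroup.LocalRing E v) (UnitaryGroup.conjLocal E c v))) * FrameTransport.frameConj F E c v (2 + 2) hJ₂D (antidiagonal_over_eq_map F E 2) Q hQ (toLocalFour F E c v (uMinus (UnitaryGroup.LocalRing E v) (UnitaryGroup.conjLocal E c v) (UnitaryGroup.conjLocal_conjLocal c v hcδ hδ) (z))) := ⟨_, rfl⟩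
  have hAw' : ∀ y, FrameTransport.frameConj F E c v (2 + 2) hJ₂D (antidiagonal_over_eq_map F E 2) Q hQ (toLocalFour F E c v (weylTwo (UnitaryGroup.LocalRing E v) (UnitaryGroup.conjLocal E c v))) * FrameTransport.frameConj F E c v (2 + 2) hJ₂D (antidiagonal_over_eq_map F E 2) Q hQ (toLocalFour F E c v (uLongTwo (UnitaryGroup.LocalRing E v) (UnitaryGroup.conjLocal E c v) (UnitaryGroup.toLocalRing E v y * algebraMap E (UnitaryGroup.LocalRing E v) δ) (conjLocal_coord F E c hcδ v y))) = Aw y := fun y => by rw [hAw]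
  have hBw' : ∀ z, FrameTransport.frameConj F E c v (2 + 2) hJ₂D (antidiagonal_over_eq_map F E 2) Q hQ (toLocalFour F E c v (weylOne (UnitaryGroup.LocalRing E v) (UnitaryGroup.conjLocal E c v))) * FrameTransport.frameConj F E c v (2 + 2) hJ₂D (antidiagonal_over_eq_map F E 2) Q hQ (toLocalFour F E c v (uMinus (UnitaryGroup.LocalRing E v) (UnitaryGroup.conjLocal E c v) (UnitaryGroup.conjLocal_conjLocal c v hcδ hδ) (z))) = Bw z := fun z => by rw [hBw]
  -- the untwisted chain is integrable on the product (★ B7-M2 + ★ B4-abs), hence so is the twisted integrand (`|ψ| = 1`)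
  have hch := chain_integrability_of_forall_eq F E c hcδ hδ hd v hT₂ hJ₂D D Dinv hDD Q hQm hQ μF e he hχ hs hSieg hsm K' hfK' w hw μw e₁ he₁ A hA h
  have hintP : Integrable (fun p : (v.adicCompletion F × UnitaryGroup.LocalRing E v × v.adicCompletion F) => f (Aw p.2.2 * (Bw p.2.1 * (Aw p.1 * h)))) (μF.prod ((Measure.map (⇑e₁) μw).prod μF)) :=
    integrable_of_iterated (μX := μF) (μZ := Measure.map (⇑e₁) μw) (μY := μF) (A := Aw) (B := Bw) (C := Aw) f h
      (by rw [hAw, hBw]; exact hch.1) (by rw [hAw]; exact hch.2.1) (by rw [hAw, hBw]; exact hch.2.2.1) (by rw [hAw, hBw]; exact hch.2.2.2)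
  have hψc : Continuous fun p : (v.adicCompletion F × UnitaryGroup.LocalRing E v × v.adicCompletion F) => (((ψ (p.1 * τ) : Circle) : ℂ)) :=
    continuous_subtype_val.comp (hψ.comp (continuous_fst.mul continuous_const))
  have hψb : ∀ p : (v.adicCompletion F × UnitaryGroup.LocalRing E v × v.adicCompletion F), ‖(((ψ (p.1 * τ) : Circle) : ℂ))‖ ≤ 1 := fun p => (Circle.norm_coe _).le
  have hintT : Integrable (fun p : (v.adicCompletion F × UnitaryGroup.LocalRing E v × v.adicCompletion F) => (((ψ (p.1 * τ) : Circle) : ℂ)) * f (Aw p.2.2 * (Bw p.2.1 * (Aw p.1 * h)))) (μF.prod ((Measure.map (⇑e₁) μw).prod μF)) :=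
    hintP.bdd_mul hψc.aestronglyMeasurable (Filter.Eventually.of_forall hψb)
  -- change of variables `u = e(x,z,y)` + Fubini (★ B4-abs pattern), the twist riding on the outermost variable
  have hword : ∀ (x : v.adicCompletion F) (z : UnitaryGroup.LocalRing E v) (y : v.adicCompletion F),
      FrameTransport.frameConj F E c v (2 + 2) hJ₂D (antidiagonal_over_eq_map F E 2) Q hQ (toLocalFour F E c v (weylSiegel (UnitaryGroup.LocalRing E v) (UnitaryGroup.conjLocal E c v))) * ((e (x, (z, y)) : unipDeltaLocal F E c v 2 (JD := J₂D)) : UnitaryGroup.localPi E c (2 + 2) J₂D v) = Aw y * Bw z * Aw x := by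
    intro x z y
    rw [he, frameConj_weylSiegel_mul_coord F E c hcδ hδ v hJ₂D Q hQ, hAw' y, hBw' z, hAw' x]
  have hcongr : ∀ p : (v.adicCompletion F × UnitaryGroup.LocalRing E v × v.adicCompletion F),
      (((ψ ((e.symm (e.toMeasurableEquiv p)).1 * τ) : Circle) : ℂ)) * f (FrameTransport.frameConj F E c v (2 + 2) hJ₂D (antidiagonal_over_eq_map F E 2) Q hQ (toLocalFour F E c v (weylSiegel (UnitaryGroup.LocalRing E v) (UnitaryGroup.conjLocal E c v))) * ((e.toMeasurableEquiv p : unipDeltaLocal F E c v 2 (JD := J₂D)) : UnitaryGroup.localPi E c (2 + 2) J₂D v) * h) =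
        (((ψ (p.1 * τ) : Circle) : ℂ)) * f (Aw p.2.2 * (Bw p.2.1 * (Aw p.1 * h))) := by
    rintro ⟨x, z, y⟩
    simp only [Homeomorph.toMeasurableEquiv_coe, Homeomorph.symm_apply_apply]
    rw [hword, mul_assoc, mul_assoc]
  have hcov : ∫ u, (((ψ ((e.symm u).1 * τ) : Circle) : ℂ)) * f (FrameTransport.frameConj F E c v (2 + 2) hJ₂D (antidiagonal_over_eq_map F E 2) Q hQ (toLocalFour F E c v (weylSiegel (UnitaryGroup.LocalRing E v) (UnitaryGroup.conjLocal E c v))) * (u : UnitaryGroup.localPi E c (2 + 2) J₂D v) * h) ∂νN =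
      ((cN : ℝ) : ℂ) * ∫ x, ∫ z, ∫ y, (((ψ (x * τ) : Circle) : ℂ)) * f (Aw y * (Bw z * (Aw x * h))) ∂μF ∂(Measure.map (⇑e₁) μw) ∂μF := by
    rw [hν, integral_smul_measure, integral_map_equiv]
    simp_rw [hcongr]
    rw [integral_prod _ hintT, ENNReal.coe_toReal, Complex.real_smul]
    congr 1
    refine integral_congr_ae ?_
    filter_upwards [hintT.prod_right_ae] with x hx
    exact integral_prod _ hx
  rw [hcov]
  -- evaluate: the two inner integrals are ★ p862057's stages A, B; the outer one is the twisted stage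
  have inner : ∀ (x : v.adicCompletion F) (z : UnitaryGroup.LocalRing E v),
      ∫ y, (((ψ (x * τ) : Circle) : ℂ)) * f (Aw y * (Bw z * (Aw x * h))) ∂μF = (((ψ (x * τ) : Circle) : ℂ)) * N₁ (Bw z * (Aw x * h)) := fun x z => by
    rw [integral_const_mul, hN₁]
    simp only [hAw]
  have middle : ∀ x : v.adicCompletion F,
      ∫ z, (((ψ (x * τ) : Circle) : ℂ)) * N₁ (Bw z * (Aw x * h)) ∂(Measure.map (⇑e₁) μw) = (((ψ (x * τ) : Circle) : ℂ)) * N₂ (Aw x * h) := fun x => by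
    rw [integral_const_mul, hμRint]
    simp only [hBw, hmid]
    rw [hN₂]
  have outer : ∫ x, (((ψ (x * τ) : Circle) : ℂ)) * N₂ (Aw x * h) ∂μF = (μF.real (primePowBall (v.adicCompletion F) 0) : ℂ) * Tw * N₂ h := by
    simp only [hAw]
    exact stageC
  have stageB' : N₂ h = (μw.real (primePowBall (w.1.adicCompletion E) 0) : ℂ) * (1 + ((χv w (-1) : ℂˣ) : ℂ) * (1 - (residueFieldCard (w.1.adicCompletion E) : ℂ)⁻¹) * (unramValue E w.1 (chiNorm F E c v χv w) * (residueFieldCard (w.1.adicCompletion E) : ℂ) ^ (1 - (2 * s + 1))) * lFactor E w.1 (chiNorm F E c v χv w) ((2 * s + 1) - 1)) * N₁ h := by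
    rw [hN₂]; exact stageB
  have stageA' : N₁ h = (μF.real (primePowBall (v.adicCompletion F) 0) : ℂ) * (1 + localSiegelCharacter F E c v 2 χv s (FrameTransport.frameConj F E c v (2 + 2) hJ₂D (antidiagonal_over_eq_map F E 2) Q hQ (toLocalFour F E c v (torusElt (UnitaryGroup.LocalRing E v) (UnitaryGroup.conjLocal E c v) (UnitaryGroup.conjLocal_conjLocal c v hcδ hδ) (1) (-((Units.mk0 δ hδ).map (algebraMap E (UnitaryGroup.LocalRing E v) : E →* UnitaryGroup.LocalRing E v))⁻¹)))) * (1 - (residueFieldCard (v.adicCompletion F) : ℂ)⁻¹) * (unramValue F v (chiF F E v χv) * (residueFieldCard (v.adicCompletion F) : ℂ) ^ (1 - (2 * s + 2))) * lFactor F v (chiF F E v χv) ((2 * s + 2) - 1)) * f h := by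
    rw [hN₁]; exact stageA
  simp_rw [inner, middle]
  rw [outer, stageB', stageA', measureReal_box_eq F E c hcδ hδ v hJ₂D Q hQ e he νN μF w μw e₁ he₁ cN hν]
  push_cast
  ring

end Summit.HodgeConjecture.HodgeConjecture.Cruxes.HLiu418.K2LiuRankOneSingularLocalValue

end
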